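import Mathlib

/-!
# Route «KPlusLogSqLaw», crux `WeakLifting` (stmt-ValiantsHypothesis-19561) — REAL side of the tridiagonal sector:
# the UNIT-COEFFICIENT sub-sector — DEFINITIONS for the PIVOT SIGN AUTOMATON (route-side `…Defs` file, D-0009 reviewed)

HONEST FRAMING.  Definitions only (nothing asserted), seat val-sym-lift-p1 (g17), cell `pub-symmetroid`, 2026-08-28, for the helper line
`--supports stmt-ValiantsHypothesis-19561` on the unit-coefficient sub-sector of the α register; consumed by
`…TridiagonalRealStaticUnitSignAutomaton` (soundness theorems and the emptiness criterion).  For a unit design with continuants `D_k(x)`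
(`D_{k+2} = x^{d_{k+1}}D_{k+1} − x^{2f_k}D_k`) the normalised pivots `π_{k+1} = D_{k+1}/(x^{d_k}D_k)` obey `π₁ = 1`, `π' = 1 − b/π` with
`b = x^{L_k}` (`L_k = 2f_k − d_k − d_{k+1}`); an edge is RECESSIVE at `x` when `b < 1`.  This file names:
* `PState` — the six abstract pivot states `E (π = 1)`, `A (0 < π < 1)`, `J (π > 1)`, `N (π < 0)`, `Z (D_{k+1} = 0)`, `P0 (D_k = 0)`;
* `step rec s` — the (non-deterministic) successor states under one edge (`rec`: recessive link), with a flag «tracked sign flips»: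
  `E →rec A`, `E →dom N`, `N → J`, `A →rec {A, Z, N}`, `A →dom N`, `J →rec A`, `J →dom {A, Z, N}`, `Z → P0`, `P0 → E`;
* `runN w n` — all branches after the first `n` edges (`w k`: edge `k` recessive), from `(E, +)`; `noZero w n` — the Boolean check «no branch
  ends in `Z`» (decidable: `by decide` on concrete words); `wordOf l` — the word of a finite sign list;
* `sgn`, `flipIf` — sign bookkeeping; `Realizes x e P Q s σ` — the real pair `(P, Q) = (D_k, D_{k+1})` with last exponent `e = d_k` is in
  state `s` with tracked sign `σ` (a PREDICATE with parameters, not a named fact).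
Nothing here bears on `WeakLifting` / `TropicalB` (stmt-19771) in their windows, Conjecture B, the Door-A registers, `MatrixDescartes`
(stmt-18050) or VP ≠ VNP.
[this seat; folklore: LDLᵀ pivots of a Jacobi matrix]
-/

-- `Summit.ValiantsHypothesis.ValiantsHypothesis.…` repeats a component by the D-0017 layout (single-conjunct summit); the name is mandated.
set_option linter.dupNamespace false
set_option autoImplicit false

namespace Summit.ValiantsHypothesis.ValiantsHypothesis.Theorems.KPlusLogSqLaw
namespace StaticTridiagonalRealUnit

/-! ### The abstract pivot automaton -/

/-- abstract state of the pair `(D_k, D_{k+1})`: `E` (`π = 1`), `A` (`0 < π < 1`), `J` (`π > 1`), `N` (`π < 0`), `Z` (`D_{k+1} = 0`), `P0` (`D_k = 0`),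
`π = D_{k+1}/(x^{d_k} D_k)`. [this file] -/
inductive PState
  | E | A | J | N | Z | P0
  deriving DecidableEq, Repr

open PState

/-- one edge: the possible successor states, with a flag recording whether the tracked sign flips (`rec = true`: recessive link). -/
def step (rec : Bool) : PState → List (PState × Bool)
  | E => if rec then [(A, false)] else [(N, true)]
  | N => [(J, false)]
  | A => if rec then [(A, false), (Z, false), (N, true)] else [(N, true)]
  | J => if rec then [(A, false)] else [(A, false), (Z, false), (N, true)]
  | Z => [(P0, true)]
  | P0 => [(E, false)]

/-- the non-deterministic run over the first `n` edges (`w k = true`: edge `k` recessive), from the start state `E` with sign `+`. -/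
def runN (w : ℕ → Bool) : ℕ → List (PState × Bool)
  | 0 => [(E, false)]
  | n + 1 => (runN w n).flatMap fun p => (step (w n) p.1).map fun q => (q.1, xor p.2 q.2)

/-- the acceptance check: no branch ends in the zero state `Z`. -/
def noZero (w : ℕ → Bool) (n : ℕ) : Bool := (runN w n).all fun p => decide (p.1 ≠ Z)

/-! ### Realisation of the abstract states by real pairs -/

/-- the tracked sign as a real unit. -/
def sgn (b : Bool) : ℝ := if b then -1 else 1

/-- composing flips multiplies signs. -/
theorem sgn_xor (a b : Bool) : sgn (xor a b) = sgn a * sgn b := by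
  cases a <;> cases b <;> simp [sgn]

/-- apply a flip flag to a sign. -/
def flipIf : Bool → ℝ → ℝ
  | true, σ => -σ
  | false, σ => σ

/-- `Realizes x e P Q s σ`: the pair `(P, Q) = (D_k, D_{k+1})` with last exponent `e = d_k` is in the abstract state `s`, the tracked sign being `σ`
(sign of `Q`, or of `P` in state `Z`). [this file] -/
def Realizes (x : ℝ) (e : ℕ) (P Q : ℝ) : PState → ℝ → Prop
  | E, σ => 0 < σ * P ∧ σ * Q = x ^ e * (σ * P)
  | A, σ => 0 < σ * Q ∧ σ * Q < x ^ e * (σ * P)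
  | J, σ => 0 < σ * P ∧ x ^ e * (σ * P) < σ * Q
  | N, σ => 0 < σ * Q ∧ σ * P < 0
  | Z, σ => Q = 0 ∧ 0 < σ * P
  | P0, σ => P = 0 ∧ 0 < σ * Q

/-- the word of a list of signs (`true` = ascending), constant `true` beyond its length. -/
def wordOf (l : List Bool) (k : ℕ) : Bool := l.getD k true

end StaticTridiagonalRealUnit
end Summit.ValiantsHypothesis.ValiantsHypothesis.Theorems.KPlusLogSqLaw
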